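import Literature.AlgebraicGeometry.ModuliOfAbelianVarieties.SiegelFineModuliScheme
import Literature.AlgebraicGeometry.AbelianSchemes.PolarizedAbelianSchemeWithLevelBaseChange
import Literature.AlgebraicGeometry.AbelianSchemes.AbelianSchemeOverSectionsBaseChange
import Literature.AlgebraicGeometry.Morphisms.ProjectiveOfPushforwardFrame
import Literature.AlgebraicGeometry.Morphisms.ProjectiveFrameLocus
import HarnessLib

/-!
# The linearly rigidified covariant `H` of polarised abelian schemes with level structure — the OUTPUT TYPE of
# [MumfordFogartyKirwan1994] Ch. 7 §2 Prop. 7.3 / Prop. 7.6 as an interface (F-DAG leaf F-8 (8α))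

Topic `AlgebraicGeometry/ModuliOfAbelianVarieties`; namespaces
`Literature.AlgebraicGeometry.AbelianSchemes.PolarizedAbelianSchemeWithLevel` (§1) and
`Literature.AlgebraicGeometry.ModuliOfAbelianVarieties` (§§2–3).  Cell hodgecm-mathlib (D-0151), F-DAG leaf F-8 «the
quotient `A⁰ := H ∕ GL_{m+1}` by slices», piece (8α) of the census `B-provers/B-p07/g17/CENSUS-F8-Quotient.B-p07g17.md`
(sequencer table B-plan1 (g16) 08:46:52Z, director s231).  ONE structure, definitions WITH BODIES (§1 two `Prop`-valued
predicates; §3 `markedPoint`, `classifyingMap`; §4 `markedTuple`, `frameOpen`, `IsFrameOn`) and plumbing theorems; no instance, no notation, no named fact,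
no `sorry`.  HC_CM is proved only modulo the 7 printed citations until rung 0 closes; nothing here is about HC.

## The source, as printed

[MumfordFogartyKirwan1994] Ch. 7 §2.  Definition 7.5 (p. 130): for an abelian scheme `π : X → S` and an invertible
sheaf `L` on `X` with `π_*L` locally free of rank `m + 1`, «a linear rigidification of `X/S` (with respect to `L`) is an
isomorphism `φ : ℙ(π_*L) ⥲ ℙ^m × S`».  Proposition 7.3 (pp. 131–134) constructs the locally closed subscheme `H` of the
Hilbert scheme of `ℙ^m` whose `T`-valued points are the closed subschemes `Z ⊂ ℙ^m × T` which are abelian schemes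
with level-`n` structure, linearly normally embedded, with `𝒪(1)|_Z` of type `L^Δ(λ)³`; Proposition 7.6 (p. 136)
identifies this functor with «polarised abelian schemes with level structure PLUS a linear rigidification with respect
to `L^Δ(λ)³`» and makes `PGL(m+1)` act by changing the rigidification.  Here `m + 1 = 6^g · d` is the rank of
`π_*(L^Δ(λ)³)` (Prop. 6.13).

## What is here (the F-6 output type, consumed by F-8 (8β)–(8ε); no moduli scheme is constructed in this file)

* §1 **`PolarizedAbelianSchemeWithLevel.IsFrameRigidification J P ι`** — the `𝐏^m_ℤ`-component
  `ι : X ⟶ 𝐏^m_ℤ` (`m = #J`) of an embedding of the total space of a triple `P = (X/T, λ, σ)` IS the morphism of a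
  GLOBAL FRAME `e : 𝒪_T^{m+1} ≅ π_*(L^Δ(λ)^{⊗3})` (in the letter of the tree's functor-side files
  `Morphisms/ProjectiveOfPushforwardFrame` / `AbelianSchemes/PolarizedLevelFrameEmbedding`: graph datum `Gr = (1, λ)`,
  `L^Δ(λ)^{⊗3} = (Gr^*𝒫)^{⊗3}`, a rank-one frame system `F`, the frame `e` of the direct image, and
  `projectiveSpace.pointOfSections` of the basis sections); and **`IsLinearRigidification J P ι`** — the same
  ZARISKI-LOCALLY ON `T` (on an open cover `𝒰` of `T`, for the restricted triples `P|_{𝒰ᵢ}`).  This is Def. 7.5 read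
  through the embedding a linear rigidification defines: frames which differ by a unit of `Γ(T, 𝒪_T)` define the same
  `ι`, so `T`-points are EMBEDDINGS, not frames (census seam (σ1)).
* §2 **`SiegelFramedCovariant g N δ J`** — the interface: a locally Noetherian `ℚ`-scheme `H`, a universal triple
  `univ` over `H` with a universal linear rigidification `emb`, and the field `represents`: every linearly rigidified
  triple `(P', ι)` over a locally Noetherian `ℚ`-scheme `T` is the pull-back of `(univ, emb)` along a UNIQUE
  `f : T → H` (the five-clause relation ★ `PolarizedAbelianSchemeWithLevel.IsBaseChangeVia` with comparison maps
  `(G, Ĝ)` and `G ≫ emb = ι`).  Prop. 7.3's `H` (over `ℚ`) is an instance (Prop. 7.6); F-8 glues `H`'s standard-frame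
  slices into the fine moduli scheme ★ `SiegelFineModuliScheme` over ANY instance.
* §3 plumbing for the consumers: the `N^{2g}` COVARIANT POINTS `markedPoint 𝓗 a : H ⟶ 𝐏^m_ℤ` (the torsion sections
  `σ^a` followed by `emb` — the input tuple of ★ `Morphisms/ProjectiveFrameLocus.frameLocus`), the classifying map
  `classifyingMap 𝓗 T P' ι h` with its relation and uniqueness, and **`comp_markedPoint`**: a classifying datum
  `(f, G, Ĝ)` of `(P', ι)` carries the marked points of `H` to the torsion points of `P'` read through `ι`
  (★ `AbelianSchemeOver.IsBaseChangeVia.sectionPow_comp`).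
* §4 (the definitions of the (8β) sub-functor file, carried here so that the F-8 chain has ONE definition file —
  pen B-p14 (g18) 08:56:22Z; all theorems about them live in `ModuliOfAbelianVarieties/SiegelModuliFrameSubfunctor`):
  **`markedTuple P ι R`** — the `(m+2)`-tuple of torsion points `σ^{R j}` of ANY triple `P` read through an
  embedding `ι` (generalising `markedPoint`); **`frameOpen P R : T.Opens`** — MFK's open set `U_R` pulled back to the
  triple: the union, over opens `U ⊆ T` and linear rigidifications `ι` of `P|_U`, of the frame loci
  (★ `ProjFrame.frameLocus`) of the marked tuple; **`IsFrameOn P R := frameOpen P R = ⊤`** — «the `R`-marked torsion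
  points are a projective frame everywhere on `T`», the open sub-functor `𝓕_R` represented by the slice `V_R`.

Deliberately NOT part of the interface: that `emb` is a closed immersion (it follows from §1 by the functor-side
files and is not used by F-8), any action of `GL_{m+1}` on `H` (road R1′ moves points by the transporter
★ `Morphisms/ProjectiveFrameTransporter` and never forms a quotient by the group), separatedness (F-9).

## References
* [MumfordFogartyKirwan1994] D. Mumford, J. Fogarty, F. Kirwan, *Geometric Invariant Theory*, 3rd ed. (1994), Ch. 7 §2
  Definition 7.2 (p. 129), Prop. 7.3 (p. 132), Def. 7.5 (p. 130), Prop. 7.6 (p. 136); Ch. 6 §2 Prop. 6.13 (p. 123).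
* [Hartshorne1977] R. Hartshorne, *Algebraic Geometry* (1977), II Thm. 7.1.
-/

noncomputable section

-- Mathlib's `Over`/pull-back API and `Scheme.Modules` section API are stated across semireducible wrappers (as in the
-- tree's functor-side files).
set_option backward.isDefEq.respectTransparency false

open CategoryTheory CategoryTheory.Limits AlgebraicGeometry
open Literature.AlgebraicGeometry.Modules
open Literature.AlgebraicGeometry.Motives Literature.AlgebraicGeometry.Motives.GeneratingSections
open Literature.AlgebraicGeometry.Morphisms

namespace Literature.AlgebraicGeometry.AbelianSchemes

namespace PolarizedAbelianSchemeWithLevel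

variable {g N : ℕ} {δ : Fin g → ℕ} (J : Type)

/-! ### §1 Linear rigidifications, read through the embedding they define -/

/-- **`ι : X → 𝐏^m_ℤ` is the morphism of a GLOBAL FRAME of `π_*(L^Δ(λ)^{⊗3})`** (`m = #J`): there are a graph datum
`Gr = (1_X, λ) : X → X ×_T X̂`, a rank-one frame system `F` of `L^Δ(λ)^{⊗3} = (Gr^*𝒫)^{⊗3}`, a frame
`e : 𝒪_T^{m+1} ≅ π_*(L^Δ(λ)^{⊗3})` of the direct image whose basis sections generate, and `ι` is the `𝐏^m_ℤ`-component
of the `T`-morphism `X → 𝐏(J; T)` they define (Hartshorne II Thm. 7.1) — Mumford's linear rigidification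
`ℙ(π_*L^Δ(λ)³) ≅ ℙ^m × T` given by an honest basis of `π_*`, recorded by the embedding it induces.
[cite: MumfordFogartyKirwan1994, Ch. 7 §2 Def. 7.5 (p. 130)] [cite: Hartshorne1977, II Thm. 7.1] -/
def IsFrameRigidification {T : Scheme.{0}} (P : PolarizedAbelianSchemeWithLevel g N δ T)
    (ι : P.A.X.left ⟶ projectiveSpaceInt J) : Prop :=
  ∃ (Gr : P.A.X.left ⟶ P.A.prodLeft P.D.hat) (_ : Gr ≫ pullback.fst P.A.X.hom P.D.hat.X.hom = 𝟙 _)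
    (_ : Gr ≫ pullback.snd P.A.X.hom P.D.hat.X.hom = P.pol.lam.left)
    (F : FrameSystem (tensorPow ((Scheme.Modules.pullback Gr).obj P.D.P) 3)) (h1 : ∀ x, F.rank x = 1)
    (e : SheafOfModules.free (Fin (Nat.card J + 1)) ≅
      ((Scheme.Modules.pushforward P.A.X.hom).obj (tensorPow ((Scheme.Modules.pullback Gr).obj P.D.P) 3)).over ⊤)
    (hcov : ⨆ i, ⨆ x, P.A.X.left.basicOpen
      ((CocycleSections.ofFrameSystem F h1 fun j ↦ (basisSection e j :)).coeff i x) = ⊤),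
    projectiveSpace.homEquiv (Over.mk P.A.X.hom)
        (projectiveSpace.pointOfSections (Over.mk P.A.X.hom)
          (ofCocycleSections F.U (CocycleSections.ofFrameSystem F h1 fun j ↦ (basisSection e j :)) hcov)) = ι

/-- **`ι : X → 𝐏^m_ℤ` is a LINEAR RIGIDIFICATION of the triple `P` over `T`**: Zariski-locally on `T` — on some open
cover `𝒰` of `T`, for every restricted triple `P|_{𝒰ᵢ}` (★ `PolarizedAbelianSchemeWithLevel.baseChange`) — the
restriction `X ×_T 𝒰ᵢ → X → 𝐏^m_ℤ` of `ι` is the morphism of a global frame of `π_*(L^Δ(λ)^{⊗3})|_{𝒰ᵢ}`.  A linear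
rigidification `ℙ(π_*L^Δ(λ)³) ≅ ℙ^m × T` of Def. 7.5 is exactly a compatible family of local frames up to units, i.e.
such an `ι`; two frames differing by a unit scalar give the same `ι` (the `T`-points of Prop. 7.3's `H` are embeddings).
[cite: MumfordFogartyKirwan1994, Ch. 7 §2 Def. 7.5 (p. 130)] [cite: MumfordFogartyKirwan1994, Ch. 7 §2 Prop. 7.6 (p. 136)] -/
def IsLinearRigidification {T : Scheme.{0}} (P : PolarizedAbelianSchemeWithLevel g N δ T)
    (ι : P.A.X.left ⟶ projectiveSpaceInt J) : Prop :=
  ∃ 𝒰 : Scheme.OpenCover.{0} T, ∀ i, (P.baseChange (𝒰.f i)).IsFrameRigidification J (pullback.fst P.A.X.hom (𝒰.f i) ≫ ι)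

/-! ### §4 Marked tuples and the frame sub-functors `𝓕_R` (definitions of the (8β) file) -/

section Subfunctor

variable {T : Scheme.{0}}

/-- **The `R`-marked tuple of a triple read through an embedding**: for an `(m+2)`-tuple `R` of exponent vectors,
the `T`-valued points `σ^{R j} ≫ ι` of `𝐏^m_ℤ`, `j < m + 2` — the points whose frame condition defines MFK's open
set `U_R` (Ch. 3 §1 Def. 3.3) on the covariant of Ch. 7 §3; the input tuple of ★ `ProjFrame.frameLocus`.
[cite: MumfordFogartyKirwan1994, Ch. 3 §1 Definition 3.3 (p. 68)] [cite: MumfordFogartyKirwan1994, Ch. 7 §3 Prop. 7.7 (p. 138)] -/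
def markedTuple (P : PolarizedAbelianSchemeWithLevel g N δ T) (ι : P.A.X.left ⟶ projectiveSpaceInt J)
    (R : Fin (Nat.card J + 2) → (Fin g ⊕ Fin g → ZMod N)) : Fin (Nat.card J + 2) → (T ⟶ projectiveSpaceInt J) :=
  fun j => (P.A.sectionPow P.level.σ (R j)).left ≫ ι

/-- Unfolding `markedTuple`. [cite: MumfordFogartyKirwan1994, Ch. 3 §1 Definition 3.3 (p. 68)] -/
theorem markedTuple_apply (P : PolarizedAbelianSchemeWithLevel g N δ T) (ι : P.A.X.left ⟶ projectiveSpaceInt J)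
    (R : Fin (Nat.card J + 2) → (Fin g ⊕ Fin g → ZMod N)) (j : Fin (Nat.card J + 2)) :
    markedTuple J P ι R j = (P.A.sectionPow P.level.σ (R j)).left ≫ ι := rfl

/-- **MFK's open set `U_R` pulled back to the triple functor**: the open subset of `T` over which the `R`-marked
torsion points are a projective frame THROUGH SOME LOCAL LINEAR RIGIDIFICATION — the union over opens `U ⊆ T`,
over linear rigidifications `ι` of the restricted triple `P|_U`, of the image in `T` of the frame locus of the marked
tuple (the frame locus does not depend on the rigidification: `Morphisms/ProjectiveFrameLocusLinearInvariance`).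
[cite: MumfordFogartyKirwan1994, Ch. 3 §1 Definition 3.3 (p. 68)] [cite: MumfordFogartyKirwan1994, Ch. 7 §2 Prop. 7.6 (p. 136)] -/
def frameOpen (P : PolarizedAbelianSchemeWithLevel g N δ T) (R : Fin (Nat.card J + 2) → (Fin g ⊕ Fin g → ZMod N)) :
    T.Opens :=
  ⨆ U : T.Opens, ⨆ ι : (P.baseChange U.ι).A.X.left ⟶ projectiveSpaceInt J,
    ⨆ (_ : (P.baseChange U.ι).IsLinearRigidification J ι), U.ι ''ᵁ ProjFrame.frameLocus (markedTuple J (P.baseChange U.ι) ι R)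

/-- **`P ∈ 𝓕_R(T)`: the `R`-marked torsion points are a projective frame EVERYWHERE on `T`** (`frameOpen = ⊤`) —
the open sub-functor of the moduli functor represented by the standard-frame slice `V_R` (Ch. 3 §1 Prop. 3.1's
`σ_R⁻¹(point)` inside `U_R`). [cite: MumfordFogartyKirwan1994, Ch. 3 §1 Definition 3.3 (p. 68)]
[cite: MumfordFogartyKirwan1994, Ch. 7 §2 Prop. 7.6 (p. 136)] -/
def IsFrameOn (P : PolarizedAbelianSchemeWithLevel g N δ T) (R : Fin (Nat.card J + 2) → (Fin g ⊕ Fin g → ZMod N)) :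
    Prop :=
  frameOpen J P R = ⊤

/-- Unfolding `IsFrameOn`. [cite: MumfordFogartyKirwan1994, Ch. 3 §1 Definition 3.3 (p. 68)] -/
theorem isFrameOn_iff (P : PolarizedAbelianSchemeWithLevel g N δ T) (R : Fin (Nat.card J + 2) → (Fin g ⊕ Fin g → ZMod N)) :
    IsFrameOn J P R ↔ frameOpen J P R = ⊤ := Iff.rfl

end Subfunctor

end PolarizedAbelianSchemeWithLevel

end Literature.AlgebraicGeometry.AbelianSchemes

namespace Literature.AlgebraicGeometry.ModuliOfAbelianVarieties

open Literature.AlgebraicGeometry.AbelianSchemes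

/-! ### §2 The interface -/

/-- **The linearly rigidified covariant `H`** of polarised abelian schemes of relative dimension `g` with polarisation of
type `δ` and symplectic-liftable level-`N` structure, embedded in `𝐏^m`, `m = #J` ([MumfordFogartyKirwan1994] Prop. 7.3's
locally closed subscheme `H` of the Hilbert scheme, read through Prop. 7.6): a locally Noetherian `ℚ`-scheme `H` with a
universal linearly rigidified triple `(univ, emb)` such that every linearly rigidified triple over a locally Noetherian
`ℚ`-scheme is its pull-back along a unique morphism to `H`.  The OUTPUT TYPE of the F-6 tower and the INPUT of the
slice construction of the fine moduli scheme (F-8); nothing is constructed here.  The index type `J` of the homogeneous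
coordinates is kept generic (no finiteness hypothesis is needed by the interface): a PRODUCER instantiates it with `Nat.card J + 1 = 6 ^ g · d` (`d = ∏ δᵢ`, the rank of
`π_*(L^Δ(λ)³)`, Prop. 6.13), e.g. `J := Fin (6 ^ g · d - 1)`, and carries that identity once.
[cite: MumfordFogartyKirwan1994, Ch. 7 §2 Prop. 7.3 (p. 132)] [cite: MumfordFogartyKirwan1994, Ch. 7 §2 Prop. 7.6 (p. 136)] -/
structure SiegelFramedCovariant (g N : ℕ) (δ : Fin g → ℕ) (J : Type) where
  /-- The covariant `H` as a `ℚ`-scheme. -/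
  H : SchemeOver ℚ
  /-- `H` is locally Noetherian (it is of finite type over `ℚ` in print). -/
  isLocallyNoetherian : IsLocallyNoetherian H.left
  /-- The universal polarised abelian scheme with level structure over `H`. -/
  univ : PolarizedAbelianSchemeWithLevel g N δ H.left
  /-- The `𝐏^m_ℤ`-component of the universal embedding `univ.X ↪ 𝐏^m × H`. -/
  emb : univ.A.X.left ⟶ Morphisms.projectiveSpaceInt J
  /-- The universal embedding is a linear rigidification (Zariski-locally on `H` the morphism of a frame of
  `π_*(L^Δ(λ)^{⊗3})`). -/
  isLinearRigidification_emb : univ.IsLinearRigidification J emb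
  /-- `H` REPRESENTS linearly rigidified triples on locally Noetherian `ℚ`-schemes: `(P', ι)` over `T` is the
  pull-back of `(univ, emb)` along a unique `f : T → H`, via comparison maps `(G, Ĝ)` with `G ≫ emb = ι`. -/
  represents : ∀ (T : SchemeOver ℚ) [IsLocallyNoetherian T.left] (P' : PolarizedAbelianSchemeWithLevel g N δ T.left)
    (ι : P'.A.X.left ⟶ Morphisms.projectiveSpaceInt J), P'.IsLinearRigidification J ι →
    ∃! f : T ⟶ H, ∃ (G : P'.A.X.left ⟶ univ.A.X.left) (Ĝ : P'.D.hat.X.left ⟶ univ.D.hat.X.left),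
      P'.IsBaseChangeVia univ f.left G Ĝ ∧ G ≫ emb = ι

namespace SiegelFramedCovariant

variable {g N : ℕ} {δ : Fin g → ℕ} {J : Type} (𝓗 : SiegelFramedCovariant g N δ J)

/-! ### §3 Plumbing: marked points and the classifying map -/

/-- The underlying scheme of the covariant (non-Prop plumbing). [cite: MumfordFogartyKirwan1994, Ch. 7 §2 Prop. 7.3 (p. 132)] -/
abbrev left : Scheme.{0} := 𝓗.H.left

/-- **The `N^{2g}` COVARIANT POINTS of `H`**: for an exponent vector `a ∈ (ℤ/N)^{2g}`, the universal torsion section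
`σ^a : H → univ.X` followed by the universal embedding — an `H`-valued point of `𝐏^m_ℤ` (the points whose projective
frames define the open sets `U_R` of the slice construction; input tuple of ★ `ProjFrame.frameLocus`).
[cite: MumfordFogartyKirwan1994, Ch. 7 §3 Prop. 7.7 (p. 138)] -/
def markedPoint (a : Fin g ⊕ Fin g → ZMod N) : 𝓗.H.left ⟶ Morphisms.projectiveSpaceInt J :=
  (𝓗.univ.A.sectionPow 𝓗.univ.level.σ a).left ≫ 𝓗.emb

/-- Unfolding `markedPoint`. [cite: MumfordFogartyKirwan1994, Ch. 7 §3 Prop. 7.7 (p. 138)] -/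
theorem markedPoint_def (a : Fin g ⊕ Fin g → ZMod N) :
    𝓗.markedPoint a = (𝓗.univ.A.sectionPow 𝓗.univ.level.σ a).left ≫ 𝓗.emb := rfl

section Classify

variable (T : SchemeOver ℚ) [IsLocallyNoetherian T.left] (P' : PolarizedAbelianSchemeWithLevel g N δ T.left)
  (ι : P'.A.X.left ⟶ Morphisms.projectiveSpaceInt J) (h : P'.IsLinearRigidification J ι)

/-- **The classifying morphism `T → H` of a linearly rigidified triple `(P', ι)`** (the unique `f` of `represents`, by
choice). [cite: MumfordFogartyKirwan1994, Ch. 7 §2 Prop. 7.6 (p. 136)] -/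
def classifyingMap : T ⟶ 𝓗.H :=
  (𝓗.represents T P' ι h).choose

/-- The classifying morphism classifies: `(P', ι)` is the pull-back of `(univ, emb)` along it.
[cite: MumfordFogartyKirwan1994, Ch. 7 §2 Prop. 7.6 (p. 136)] -/
theorem exists_isBaseChangeVia_classifyingMap :
    ∃ (G : P'.A.X.left ⟶ 𝓗.univ.A.X.left) (Ĝ : P'.D.hat.X.left ⟶ 𝓗.univ.D.hat.X.left),
      P'.IsBaseChangeVia 𝓗.univ (𝓗.classifyingMap T P' ι h).left G Ĝ ∧ G ≫ 𝓗.emb = ι :=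
  (𝓗.represents T P' ι h).choose_spec.1

/-- **Uniqueness of the classifying morphism**: any `f : T → H` along which `(P', ι)` is a pull-back of `(univ, emb)`
is the classifying morphism. [cite: MumfordFogartyKirwan1994, Ch. 7 §2 Prop. 7.6 (p. 136)] -/
theorem eq_classifyingMap {f : T ⟶ 𝓗.H} {G : P'.A.X.left ⟶ 𝓗.univ.A.X.left}
    {Ĝ : P'.D.hat.X.left ⟶ 𝓗.univ.D.hat.X.left} (hf : P'.IsBaseChangeVia 𝓗.univ f.left G Ĝ) (hG : G ≫ 𝓗.emb = ι) :
    f = 𝓗.classifyingMap T P' ι h :=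
  (𝓗.represents T P' ι h).choose_spec.2 f ⟨G, Ĝ, hf, hG⟩

/-- **Two classifying data have the same morphism**: if `(P', ι)` is a pull-back of `(univ, emb)` along `f₁` and along
`f₂`, then `f₁ = f₂`. [cite: MumfordFogartyKirwan1994, Ch. 7 §2 Prop. 7.6 (p. 136)] -/
theorem classifying_unique (h : P'.IsLinearRigidification J ι) {f₁ f₂ : T ⟶ 𝓗.H} {G₁ G₂ : P'.A.X.left ⟶ 𝓗.univ.A.X.left}
    {Ĝ₁ Ĝ₂ : P'.D.hat.X.left ⟶ 𝓗.univ.D.hat.X.left} (h₁ : P'.IsBaseChangeVia 𝓗.univ f₁.left G₁ Ĝ₁)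
    (hG₁ : G₁ ≫ 𝓗.emb = ι) (h₂ : P'.IsBaseChangeVia 𝓗.univ f₂.left G₂ Ĝ₂) (hG₂ : G₂ ≫ 𝓗.emb = ι) : f₁ = f₂ := by
  rw [𝓗.eq_classifyingMap T P' ι h h₁ hG₁, 𝓗.eq_classifyingMap T P' ι h h₂ hG₂]

end Classify

/-- **A classifying datum carries the covariant points of `H` to the torsion points of `P'` read through `ι`**: if
`(P', ι)` over `T` is the pull-back of `(univ, emb)` along `f` via `(G, Ĝ)` with `G ≫ emb = ι`, then
`f ≫ markedPoint a = σ'^a ≫ ι` for every exponent vector `a` (the level clause `σ'ᵢ ≫ G = f ≫ σᵢ` of the relation,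
multiplied out by ★ `AbelianSchemeOver.IsBaseChangeVia.sectionPow_comp`).
[cite: MumfordFogartyKirwan1994, Ch. 7 §2 Definition 7.2 (p. 129)] -/
theorem comp_markedPoint {T : Scheme.{0}} {P' : PolarizedAbelianSchemeWithLevel g N δ T}
    {ι : P'.A.X.left ⟶ Morphisms.projectiveSpaceInt J} {f : T ⟶ 𝓗.H.left} {G : P'.A.X.left ⟶ 𝓗.univ.A.X.left}
    {Ĝ : P'.D.hat.X.left ⟶ 𝓗.univ.D.hat.X.left} (hf : P'.IsBaseChangeVia 𝓗.univ f G Ĝ) (hG : G ≫ 𝓗.emb = ι)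
    (a : Fin g ⊕ Fin g → ZMod N) :
    f ≫ 𝓗.markedPoint a = (P'.A.sectionPow P'.level.σ a).left ≫ ι := by
  rw [markedPoint_def, ← Category.assoc, ← hf.1.1.sectionPow_comp hf.1.2 a, Category.assoc, hG]

end SiegelFramedCovariant

end Literature.AlgebraicGeometry.ModuliOfAbelianVarieties

end
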